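/-
Copyright (c) 2026. All rights reserved.
Released under Apache 2.0 license as described in the file LICENSE.
-/
import Literature.NumberTheory.GaloisRepresentations.HOneRestrictionOntoInvariantsFinite
import Literature.NumberTheory.GaloisRepresentations.TameInertiaGeneratorEvaluationProofs
import Literature.NumberTheory.GaloisRepresentations.InertiaHomFrobeniusTwist
import Literature.NumberTheory.GaloisRepresentations.InertiaRootsOfUnity
import Literature.NumberTheory.GaloisRepresentations.ContinuousH1TrivialAction
import Literature.NumberTheory.GaloisRepresentations.ContinuousCohomologyConnecting
import HarnessLib

/-!
# A RAMIFIED class in `H¹(F, B)` from a `q`-eigenvector of Frobenius on an unramified finite module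

Topic `NumberTheory/GaloisRepresentations`; namespace `Literature.NumberTheory.GaloisRepresentations`.
THEOREMS ONLY (no definition, no named fact, no instance, no `sorry`).

Let `F` be a non-archimedean local field with residue field of `q` elements and residue characteristic `ℓ`,
`I_F = absInertia F`, and `B` a FINITE discrete `Γ_F`-module which is UNRAMIFIED (`I_F` acts trivially), `p`-primary
for a prime `p ≠ ℓ` and of order prime to `ℓ`.  If an arithmetic Frobenius `φ` has a non-zero `q`-EIGENVECTOR
`b ∈ B` (`φ b = q·b`), then `H¹(F, B) → H¹(I_F, B)` is NOT the zero map: there is a continuous `1`-cocycle `ξ` of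
`Γ_F` with `ξ(σ₀) = b ≠ 0` at a tame `p`-generator `σ₀ ∈ I_F`.

This is the non-vanishing of the «singular ∕ ordinary» quotient `H¹(F, B)/H¹_ur(F, B) ≅ H¹(I_F, B)^{Fr} =
Hom(I_F, B)^{Fr} ≅ B(−1)^{Fr}` when `B(−1)^{Fr} ∋ b ⊗ ζ^{−1} ≠ 0` (Rubin, *Euler systems*, Lemma 1.3.2 (i) with
`H¹(I, B)^{Fr} = Hom(I, B)^{Fr=1}`; for `B = E[p] ≅ 𝔽_p ⊕ μ_p` at a Bertolini–Darmon admissible prime this is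
[Howard2006] Lem. 2.2.1, `H¹_ord(K_𝔮, E[p]) = H¹(K_𝔮, μ_p) ≅ 𝔽_p ≠ 0`, the target line of the first reciprocity law
of a bipartite Euler system).

Proof (all inputs in the tree): a tame `p`-generator `σ₀ ∈ I_F` with evaluation `Hom_cont(I_F, B) ≃ B`
(`exists_absInertia_tame_generator`, Serre 1972 §1.3/§1.7) gives a continuous homomorphism `f : I_F → B` with
`f σ₀ = b`; Frobenius conjugation multiplies tame homomorphisms by `q` (`apply_frob_conj_eq_card_nsmul`, Serre 1972
§1.8 Prop. 6), and `φ ∘ f = q·f` (both continuous homomorphisms agree at `σ₀`), so the class of `f` in `H¹(I_F, B)`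
is Frobenius-invariant; `H¹(F, B) ↠ H¹(I_F, B)^{Fr}` (`exists_resSubgroup_absInertia_eq_of_conjMap_eq`, `cd Ẑ = 1`)
extends it to `Γ_F`; with trivial action on `I_F` a class determines its cocycle (`oneCocycleClass_injective_of_trivial`).

* `exists_contOneCocycles_apply_absInertia_eq_of_frob_eigenvector` — the cocycle `ξ` of `Γ_F` with `ξ|_{I_F}` a
  homomorphism taking the value `b` at `σ₀`.
* `exists_resSubgroup_absInertia_ne_zero_of_frob_eigenvector` — `res : H¹(F, B) → H¹(I_F, B)` is non-zero.

BSD is not proved by any of this.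

References: [cite: Rubin2000, Lemma 1.3.2] [cite: Howard2006, Lem. 2.2.1] [cite: SerreInventiones1972, §1.3 Prop. 2,
§1.7 Prop. 5, §1.8 Prop. 6] [cite: SerreGaloisCohomology1997, I §2.3].
-/

noncomputable section

open CategoryTheory
open scoped Pointwise Valued
open Field ValuativeRel

universe u

namespace Literature.NumberTheory.GaloisRepresentations

open GaloisRepresentations.IsNonarchimedeanLocalField
open _root_.TopRep _root_.ContinuousCohomology
open Literature.NumberTheory.EllipticCurves (subgroupConj subgroupConj_apply_coe)

variable (F : Type u) [Field F] [ValuativeRel F] [TopologicalSpace F] [IsNonarchimedeanLocalField F]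
variable {B : Type u} [AddCommGroup B] [TopologicalSpace B] [DiscreteTopology B] [Finite B]

/-- **A ramified cocycle from a `q`-eigenvector of Frobenius.**  `F` a non-archimedean local field with residue field
of `q = residueFieldCard F` elements, `B` a finite discrete `Γ_F`-module, `p`-primary for a prime `p ≠` residue
characteristic and of order prime to the residue characteristic, UNRAMIFIED (`I_F` acts trivially); `φ ∈ Γ_F` an
arithmetic Frobenius and `b ∈ B` with `φ b = q·b`.  Then there is a continuous `1`-cocycle `ξ` of `Γ_F` with values
in `B` and a (tame `p`-generator) `σ₀ ∈ I_F` with `ξ(σ₀) = b`.  (So for `b ≠ 0` the class of `ξ` is RAMIFIED: its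
restriction to `I_F`, a homomorphism since the action is trivial there, does not vanish.)
[cite: Rubin2000, Lemma 1.3.2] [cite: SerreInventiones1972, §1.8 Prop. 6] [cite: Howard2006, Lem. 2.2.1] -/
theorem exists_contOneCocycles_apply_absInertia_eq_of_frob_eigenvector
    (τ : ContinuousRep (absoluteGaloisGroup F) ℤ B) {p : ℕ} [Fact p.Prime] (hℓ : ringChar 𝓀[F] ≠ p)
    (hB : ∀ b : B, ∃ k : ℕ, p ^ k • b = 0) (hcop : (Nat.card B).Coprime (ringChar 𝓀[F]))
    (hunr : ∀ σ ∈ absInertia F, ∀ b : B, τ σ b = b)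
    {φ : absoluteGaloisGroup F} (hφ : IsAbsArithFrob φ) {b : B} (heig : τ φ b = residueFieldCard F • b) :
    ∃ (ξ : contOneCocycles τ.toTopRep) (σ₀ : absInertia F), ξ.1 σ₀ = b := by
  classical
  -- a tame `p`-generator `σ₀` and a continuous homomorphism `f : I_F → B` with `f σ₀ = b`
  obtain ⟨σ₀, -, hσ₀⟩ := exists_absInertia_tame_generator.{u, u, u} F (Fact.out : p.Prime) hℓ
  obtain ⟨hinj, hsurj⟩ := hσ₀ B hB
  obtain ⟨f, hfc, hf, hfσ₀⟩ := hsurj b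
  -- Frobenius equivariance on inertia: `φ (f σ) = q • f σ` (both sides are continuous homomorphisms of `σ`
  -- agreeing at `σ₀`)
  have hequiv : ∀ σ : absInertia F, τ φ (f σ) = residueFieldCard F • f σ := by
    have h0 := hinj (fun σ => τ φ (f σ) - residueFieldCard F • f σ)
      ((continuous_of_discreteTopology (f := fun x : B => τ φ x - residueFieldCard F • x)).comp hfc)
      (fun σ σ' => by simp only [hf, map_add, smul_add]; abel)
      (by simp only [hfσ₀, heig, sub_self])
    intro σ
    exact sub_eq_zero.mp (h0 σ)
  -- the homomorphism `f` as a `1`-cocycle of `I_F` (trivial action)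
  set X := subgroupRep τ.toTopRep (absInertia F) with hXdef
  have htriv : ∀ (g : absInertia F) (x : X), X.ρ g x = x := fun g x => hunr g g.2 x
  let y : contOneCocycles X :=
    ⟨ContinuousMap.mk f hfc, fun g h => by
      change f (g * h) = f g + X.ρ g (f h)
      rw [htriv]; exact hf g h⟩
  have hy : ∀ σ : absInertia F, y.1 σ = f σ := fun _ => rfl
  -- its class is Frobenius-invariant
  have hinv : conjMap τ.toTopRep (absInertia F) φ 1 (oneCocycleClass X y) = oneCocycleClass X y := by
    rw [conjMap_oneCocycleClass]
    congr 1
    apply Subtype.ext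
    ext x
    rw [conj_pullback_apply]
    set x' : absInertia F := subgroupConj (absInertia F) φ x with hx'def
    have hxx' : (⟨φ * (x' : absoluteGaloisGroup F) * φ⁻¹,
        (inferInstance : (absInertia F).Normal).conj_mem _ x'.2 φ⟩ : absInertia F) = x :=
      Subtype.ext (by
        change φ * (φ⁻¹ * (x : absoluteGaloisGroup F) * φ) * φ⁻¹ = x
        group)
    have key := apply_frob_conj_eq_card_nsmul F hcop f hf hfc hφ x'
    rw [hxx'] at key
    change τ φ (f x') = f x
    rw [hequiv x', key]
  -- extend to `Γ_F` (`H¹(F, B) ↠ H¹(I_F, B)^{Fr}`) and read the cocycle back on `I_F`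
  obtain ⟨xc, hxc⟩ := exists_resSubgroup_absInertia_eq_of_conjMap_eq F τ
    (IsAbsArithFrob.isFrobPow_holds hφ) (oneCocycleClass X y) hinv
  obtain ⟨ξ, rfl⟩ := oneCocycleClass_surjective τ.toTopRep xc
  rw [resSubgroup_oneCocycleClass] at hxc
  have hres := oneCocycleClass_injective_of_trivial X htriv hxc
  refine ⟨ξ, σ₀, ?_⟩
  have hval : ξ.1 (σ₀ : absoluteGaloisGroup F) = f σ₀ := congrArg (fun z : contOneCocycles X => z.1 σ₀) hres
  rw [hfσ₀] at hval
  exact hval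

/-- **`res : H¹(F, B) → H¹(I_F, B)` is NOT zero** under the hypotheses of
`exists_contOneCocycles_apply_absInertia_eq_of_frob_eigenvector` with `b ≠ 0`: some class of `H¹(F, B)` has non-zero
restriction to the inertia group — a RAMIFIED class («`H¹(F,B)/H¹_ur(F,B) ≅ H¹(I_F,B)^{Fr} ≠ 0`»; for `B = E[p]` at a
Bertolini–Darmon admissible prime, «`H¹_ord(K_𝔮, E[p]) ≅ 𝔽_p`»). [cite: Rubin2000, Lemma 1.3.2]
[cite: Howard2006, Lem. 2.2.1] -/
theorem exists_resSubgroup_absInertia_ne_zero_of_frob_eigenvector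
    (τ : ContinuousRep (absoluteGaloisGroup F) ℤ B) {p : ℕ} [Fact p.Prime] (hℓ : ringChar 𝓀[F] ≠ p)
    (hB : ∀ b : B, ∃ k : ℕ, p ^ k • b = 0) (hcop : (Nat.card B).Coprime (ringChar 𝓀[F]))
    (hunr : ∀ σ ∈ absInertia F, ∀ b : B, τ σ b = b)
    {φ : absoluteGaloisGroup F} (hφ : IsAbsArithFrob φ) {b : B} (hb : b ≠ 0)
    (heig : τ φ b = residueFieldCard F • b) :
    ∃ xc : continuousCohomology 1 τ.toTopRep, resSubgroup τ.toTopRep (absInertia F) 1 xc ≠ 0 := by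
  obtain ⟨ξ, σ₀, hξ⟩ :=
    exists_contOneCocycles_apply_absInertia_eq_of_frob_eigenvector F τ hℓ hB hcop hunr hφ heig
  refine ⟨oneCocycleClass _ ξ, fun h0 => hb ?_⟩
  rw [resSubgroup_oneCocycleClass, oneCocycleClass_eq_zero_iff] at h0
  obtain ⟨v, hv⟩ := h0
  have h1 : ξ.1 (σ₀ : absoluteGaloisGroup F) = (subgroupRep τ.toTopRep (absInertia F)).ρ σ₀ v - v := hv σ₀
  -- on `I_F` the action is trivial, so the coboundary of `v` vanishes
  have h2 : (subgroupRep τ.toTopRep (absInertia F)).ρ σ₀ v = v := hunr σ₀ σ₀.2 v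
  rw [h2, sub_self] at h1
  rw [← hξ]
  exact h1

end Literature.NumberTheory.GaloisRepresentations

end
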